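import Summits.QuantumFields.YangMills.Theses.ContractibleFibre

/-!
# `FibreToTorus` — negative lemma: the rate `0 < m` carries ALL the content of the hypothesis
# (with it deleted the crux is the target `UniformLatticeGap` verbatim)

Support file for crux `stmt-QuantumFields-16244`
(`Summit.QuantumFields.YangMills.Theses.ContractibleFibre.FibreToTorus`, route `ContractibleFibre`, rank 4),
extracted from the standing disprover's work file `Cruxes/FibreToTorus/Disproof.lean` §3 (cycle 1).  The bodies are
written out inline (no auxiliary `def … : Prop`); tree objects only.

* `cov_ratio_le_two` — a ratio-of-integrals Gibbs average `Ex F = (∫ F e^{act} dν)/(∫ e^{act} dν)` over a compact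
  configuration space with a probability reference measure and a continuous action is a genuine average:
  `|Ex (F₁G₂) − Ex F₁ · Ex G₂| ≤ 2` for `|F₁|, |G₂| ≤ 1` (no measurability needed).  This is the shape of the route
  file's inline tube expectation `Ex` (`ν` = product of Haar probability measures, `act = β Σ ins · Re tr r.ρ(U_P)`
  continuous), which is therefore never a junk `0/0`.
* `tube_rate_zero` — with rate `m = 0` the free-tube clustering predicate `Tube M β m C w Lmin` of the route file
  holds for EVERY compact `G`, faithful `r`, width `M`, coupling `β` (either sign) and slab width `w`, with `C = 2`,
  `Lmin = 0`.
* `fibreToTorus_noRate_iff_uniformLatticeGap` — hence the crux with `0 < m ∧` deleted from its hypothesis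
  (conclusion verbatim) is EQUIVALENT to the target item `UniformLatticeGap` (stmt-QuantumFields-8778): the
  positivity of ONE rate serving all volumes `L ≥ Lmin(M)` through `2n < L` (with `n` unbounded) — a uniform-in-`L`,
  uniform-in-`M` spectral statement about the free-fibre transfer matrices — is the entire non-trivial content of
  the hypothesis; the same tautology disposes of the mutations "`C` may depend on `L`" and "`∃ L` for `∀ L ≥ Lmin`".

Nothing here asserts a statement of the route (negative/support lane, `--supports stmt-QuantumFields-16244`). [folklore]
-/

noncomputable section

namespace Summit.QuantumFields.YangMills.Theorems.FibreToTorus.Negative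

open MeasureTheory Filter
open Literature.MathematicalPhysics.QuantumFieldTheory

/-- **A ratio-of-integrals Gibbs average is a genuine average.** For a continuous `act` on a compact configuration
space with a probability reference measure `ν`: `|Ex (F₁G₂) − Ex F₁ · Ex G₂| ≤ 2` for `|F₁|, |G₂| ≤ 1`, where
`Ex F = (∫ F e^{act} dν)/(∫ e^{act} dν)` (the normaliser is positive; non-integrable numerators give `0`). [folklore] -/
theorem cov_ratio_le_two {Ω : Type*} [MeasurableSpace Ω] [TopologicalSpace Ω] [OpensMeasurableSpace Ω]
    [CompactSpace Ω] (ν : Measure Ω) [IsProbabilityMeasure ν] {act : Ω → ℝ} (hact : Continuous act)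
    {F₁ G₂ : Ω → ℝ} (h1 : ∀ U, |F₁ U| ≤ 1) (h2 : ∀ U, |G₂ U| ≤ 1) :
    |(∫ U, F₁ U * G₂ U * Real.exp (act U) ∂ν) / (∫ U, Real.exp (act U) ∂ν) -
      (∫ U, F₁ U * Real.exp (act U) ∂ν) / (∫ U, Real.exp (act U) ∂ν) *
        ((∫ U, G₂ U * Real.exp (act U) ∂ν) / (∫ U, Real.exp (act U) ∂ν))| ≤ 2 := by
  have hw_cont : Continuous fun U => Real.exp (act U) := Real.continuous_exp.comp hact
  have hw_int : Integrable (fun U => Real.exp (act U)) ν :=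
    hw_cont.integrable_of_hasCompactSupport (isClosed_tsupport _).isCompact
  have hw0 : ∀ U, 0 ≤ Real.exp (act U) := fun U => (Real.exp_pos _).le
  have hZ : 0 < ∫ U, Real.exp (act U) ∂ν := integral_exp_pos hw_int
  -- the generic bound `|Ex H| ≤ 1` for `|H| ≤ 1`
  have key : ∀ {H : Ω → ℝ}, (∀ U, |H U| ≤ 1) →
      |(∫ U, H U * Real.exp (act U) ∂ν) / (∫ U, Real.exp (act U) ∂ν)| ≤ 1 := by
    intro H hH1
    rw [abs_div, abs_of_pos hZ, div_le_one hZ]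
    calc |∫ U, H U * Real.exp (act U) ∂ν| ≤ ∫ U, |H U * Real.exp (act U)| ∂ν := abs_integral_le_integral_abs
      _ ≤ ∫ U, Real.exp (act U) ∂ν := by
          refine integral_mono_of_nonneg (Eventually.of_forall fun U => abs_nonneg _) hw_int
            (Eventually.of_forall fun U => ?_)
          show |H U * Real.exp (act U)| ≤ Real.exp (act U)
          rw [abs_mul, abs_of_nonneg (hw0 U)]
          exact mul_le_of_le_one_left (hw0 U) (hH1 U)
  have hA : |(∫ U, F₁ U * G₂ U * Real.exp (act U) ∂ν) / (∫ U, Real.exp (act U) ∂ν)| ≤ 1 :=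
    key fun U => by rw [abs_mul]; exact mul_le_one₀ (h1 U) (abs_nonneg _) (h2 U)
  have hB := key h1
  have hC := key h2
  calc _ ≤ |(∫ U, F₁ U * G₂ U * Real.exp (act U) ∂ν) / (∫ U, Real.exp (act U) ∂ν)| +
        |(∫ U, F₁ U * Real.exp (act U) ∂ν) / (∫ U, Real.exp (act U) ∂ν) *
          ((∫ U, G₂ U * Real.exp (act U) ∂ν) / (∫ U, Real.exp (act U) ∂ν))| := abs_sub _ _
    _ ≤ 1 + 1 * 1 := by
        rw [abs_mul]
        exact add_le_add hA (mul_le_mul hB hC (abs_nonneg _) zero_le_one)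
    _ = 2 := by norm_num

/-- **With rate `m = 0` the free-tube predicate is a tautology.**  For EVERY compact `G`, faithful `r`, width
`M`, coupling `β` and slab width `w`: the route file's `Tube M β 0 2 w 0` (verbatim inline vocabulary) — the tube
expectation is a genuine normalised Gibbs average (`cov_ratio_le_two` with `ν` the product of Haar probability
measures and the continuous action `β Σ ins · Re tr r.ρ(U_P)`), so every connected correlation of slab observables
with `|F| ≤ 1` is `≤ 2 = 2·e^{-0·n}`. [folklore] -/
theorem tube_rate_zero (G : Type) [Group G] [TopologicalSpace G] [IsTopologicalGroup G] [CompactSpace G]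
    [MeasurableSpace G] [BorelSpace G] (r : LatticeRep G) (M : ℕ) (β : ℝ) (w : ℕ) :
    let Tube := fun (M : ℕ) (β m C : ℝ) (w Lmin : ℕ) => ∀ (L : ℕ) [NeZero L], Lmin ≤ L → let St := ZMod L × ZMod L × Fin (M + 1) × Fin (M + 1); let Cfg := St × Fin 4 → G; let ν : MeasureTheory.Measure Cfg := MeasureTheory.Measure.pi fun _ => haarProbability G; let sh : St → Fin 4 → St := fun x μ => ![(x.1 + 1, x.2.1, x.2.2.1, x.2.2.2), (x.1, x.2.1 + 1, x.2.2.1, x.2.2.2), (x.1, x.2.1, x.2.2.1 + 1, x.2.2.2), (x.1, x.2.1, x.2.2.1, x.2.2.2 + 1)] μ; let ins : St → Fin 4 → Fin 4 → ℝ := fun x μ κ => if ((μ = 2 ∨ κ = 2) → (x.2.2.1 : ℕ) < M) ∧ ((μ = 3 ∨ κ = 3) → (x.2.2.2 : ℕ) < M) then 1 else 0; let pl : Cfg → St → Fin 4 → Fin 4 → G := fun U x μ κ => U (x, μ) * U (sh x μ, κ) * (U (sh x κ, μ))⁻¹ * (U (x, κ))⁻¹; let act : Cfg → ℝ := fun U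 => β * ∑ x : St, ∑ q : {q : Fin 4 × Fin 4 // q.1 < q.2}, ins x q.1.1 q.1.2 * (r.ρ (pl U x q.1.1 q.1.2)).trace.re; let wgt : Cfg → ℝ := fun U => Real.exp (act U); let Ex : (Cfg → ℝ) → ℝ := fun F => (∫ U, F U * wgt U ∂ν) / (∫ U, wgt U ∂ν); let σ : ℕ → Cfg → Cfg := fun n U p => U ((p.1.1 + n, p.1.2), p.2); ∀ c : ZMod L, let Loc := fun F : Cfg → ℝ => Measurable F ∧ (∀ U, |F U| ≤ 1) ∧ ∀ U U', (∀ p : St × Fin 4, (p.1.1 - c).val ≤ w → U p = U' p) → F U = F U'; ∀ F₁ F₂ : Cfg → ℝ, Loc F₁ → Loc F₂ → ∀ n : ℕ, 2 * n < L → |Ex (fun U => F₁ U * F₂ (σ n U)) - Ex F₁ * Ex (fun U => F₂ (σ n U))| ≤ C * Real.exp (-(m * n)); Tube M β 0 2 w 0 := by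
  haveI : SecondCountableTopology G :=
    (r.continuous.isClosedEmbedding r.injective).isEmbedding.secondCountableTopology
  have hρ : Continuous fun g : G => ((r.ρ g).trace).re :=
    Complex.continuous_re.comp r.continuous.matrix_trace
  intro Tube L _ _
  dsimp only [Tube]
  intro c F₁ F₂ hF₁ hF₂ n _
  refine (cov_ratio_le_two (MeasureTheory.Measure.pi fun _ => haarProbability G) ?_ hF₁.2.1
    (fun U => hF₂.2.1 _)).trans_eq ?_
  · refine continuous_const.mul (continuous_finsetSum _ fun x _ =>
      continuous_finsetSum _ fun q _ => continuous_const.mul (hρ.comp ?_))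
    fun_prop
  · simp

/-- Sanity (kernel-checked): the crux with its hypothesis written exactly as below but WITH `0 < m ∧` is
`FibreToTorus` by `Iff.rfl` — so the theorem below mutates one clause and nothing else. -/
example : Summit.QuantumFields.YangMills.Theses.ContractibleFibre.FibreToTorus ↔
    (∀ (G : Type) [Group G] [TopologicalSpace G] [IsTopologicalGroup G] [CompactSpace G], IsCompactSimpleLieGroup G → letI : MeasurableSpace G := borel G; haveI : BorelSpace G := ⟨rfl⟩; ∀ r : LatticeRep G, let Tube := fun (M : ℕ) (β m C : ℝ) (w Lmin : ℕ) => ∀ (L : ℕ) [NeZero L], Lmin ≤ L → let St := ZMod L × ZMod L × Fin (M + 1) × Fin (M + 1); let Cfg := St × Fin 4 → G; let ν : MeasureTheory.Measure Cfg := MeasureTheory.Measure.pi fun _ => haarProbability G; let sh : St → Fin 4 → St := fun x μ => ![(x.1 + 1, x.2.1, x.2.2.1, x.2.2.2), (x.1, x.2.1 + 1, x.2.2.1, x.2.2.2), (x.1, x.2.1, x.2.2.1 + 1, x.2.2.2), (x.1, x.2.1, x.2.2.1, x.2.2.2 + 1)] μ; let ins : St → Fin 4 → Fin 4 → ℝ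 := fun x μ κ => if ((μ = 2 ∨ κ = 2) → (x.2.2.1 : ℕ) < M) ∧ ((μ = 3 ∨ κ = 3) → (x.2.2.2 : ℕ) < M) then 1 else 0; let pl : Cfg → St → Fin 4 → Fin 4 → G := fun U x μ κ => U (x, μ) * U (sh x μ, κ) * (U (sh x κ, μ))⁻¹ * (U (x, κ))⁻¹; let act : Cfg → ℝ := fun U => β * ∑ x : St, ∑ q : {q : Fin 4 × Fin 4 // q.1 < q.2}, ins x q.1.1 q.1.2 * (r.ρ (pl U x q.1.1 q.1.2)).trace.re; let wgt : Cfg → ℝ := fun U => Real.exp (act U); let Ex : (Cfg → ℝ) → ℝ := fun F => (∫ U, F U * wgt U ∂ν) / (∫ U, wgt U ∂ν); let σ : ℕ → Cfg → Cfg := fun n U p => U ((p.1.1 + n, p.1.2), p.2); ∀ c : ZMod L, let Loc := fun F : Cfg → ℝ => Measurable F ∧ (∀ U, |F U| ≤ 1) ∧ ∀ U U', (∀ p : St × Fin 4, (p.1.1 - c).val ≤ w → U p = U' p) → F U = F U'; ∀ F₁ F₂ : Cfg → ℝ, Loc F₁ → Loc F₂ → ∀ n : ℕ, 2 * n < L →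 |Ex (fun U => F₁ U * F₂ (σ n U)) - Ex F₁ * Ex (fun U => F₂ (σ n U))| ≤ C * Real.exp (-(m * n)); (∃ β₁ : ℝ, ∀ β : ℝ, β₁ ≤ β → ∃ m : ℝ, 0 < m ∧ ∀ w : ℕ, ∃ C : ℝ, ∀ M : ℕ, ∃ Lmin : ℕ, Tube M β m C w Lmin) → ∃ β₀ : ℝ, ∀ β : ℝ, β₀ ≤ β → ∃ m : ℝ, 0 < m ∧ ∃ S₁ : ℕ, ∀ A B : YMSpecies G, ∃ C : ℝ, ∀ S n : ℕ, S₁ ≤ S → n ≤ S → |latticeConnectedCorr r.ρ β (2 * S + 1) A.F B.F n| ≤ C * Real.exp (-(m * n))) :=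
  Iff.rfl

/-- **Without the rate the crux IS the target.**  `FibreToTorus` with `0 < m ∧` deleted from its hypothesis
(left; conclusion verbatim) is EQUIVALENT to `UniformLatticeGap` (stmt-QuantumFields-8778).  (`→`: the rate-free
hypothesis holds for every `(G, r)` by `tube_rate_zero` — `m = 0`, `C = 2`, `Lmin = 0` — and the conclusion for the
Borel σ-algebra is the conclusion for any `[BorelSpace G]` structure; `←`: the target gives the conclusion
outright.)  So the positivity of one rate `m` serving all `L ≥ Lmin(M)` through `2n < L` is the whole content of
the hypothesis of `FibreToTorus`. [folklore] -/
theorem fibreToTorus_noRate_iff_uniformLatticeGap :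
    (∀ (G : Type) [Group G] [TopologicalSpace G] [IsTopologicalGroup G] [CompactSpace G], IsCompactSimpleLieGroup G → letI : MeasurableSpace G := borel G; haveI : BorelSpace G := ⟨rfl⟩; ∀ r : LatticeRep G, let Tube := fun (M : ℕ) (β m C : ℝ) (w Lmin : ℕ) => ∀ (L : ℕ) [NeZero L], Lmin ≤ L → let St := ZMod L × ZMod L × Fin (M + 1) × Fin (M + 1); let Cfg := St × Fin 4 → G; let ν : MeasureTheory.Measure Cfg := MeasureTheory.Measure.pi fun _ => haarProbability G; let sh : St → Fin 4 → St := fun x μ => ![(x.1 + 1, x.2.1, x.2.2.1, x.2.2.2), (x.1, x.2.1 + 1, x.2.2.1, x.2.2.2), (x.1, x.2.1, x.2.2.1 + 1, x.2.2.2), (x.1, x.2.1, x.2.2.1, x.2.2.2 + 1)] μ; let ins : St → Fin 4 → Fin 4 → ℝ := fun x μ κ => if ((μ = 2 ∨ κ = 2) → (x.2.2.1 : ℕ) < M) ∧ ((μ = 3 ∨ κ = 3) → (x.2.2.2 : ℕ) < M) then 1 else 0; let pl : Cfg → St → Fin 4 → Fin 4 → G := fun U x μ κ => U (x, μ) * U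 (sh x μ, κ) * (U (sh x κ, μ))⁻¹ * (U (x, κ))⁻¹; let act : Cfg → ℝ := fun U => β * ∑ x : St, ∑ q : {q : Fin 4 × Fin 4 // q.1 < q.2}, ins x q.1.1 q.1.2 * (r.ρ (pl U x q.1.1 q.1.2)).trace.re; let wgt : Cfg → ℝ := fun U => Real.exp (act U); let Ex : (Cfg → ℝ) → ℝ := fun F => (∫ U, F U * wgt U ∂ν) / (∫ U, wgt U ∂ν); let σ : ℕ → Cfg → Cfg := fun n U p => U ((p.1.1 + n, p.1.2), p.2); ∀ c : ZMod L, let Loc := fun F : Cfg → ℝ => Measurable F ∧ (∀ U, |F U| ≤ 1) ∧ ∀ U U', (∀ p : St × Fin 4, (p.1.1 - c).val ≤ w → U p = U' p) → F U = F U'; ∀ F₁ F₂ : Cfg → ℝ, Loc F₁ → Loc F₂ → ∀ n : ℕ, 2 * n < L → |Ex (fun U => F₁ U * F₂ (σ n U)) - Ex F₁ * Ex (fun U => F₂ (σ n U))| ≤ C * Real.exp (-(m * n)); (∃ β₁ : ℝ, ∀ β : ℝ, β₁ ≤ β → ∃ m : ℝ, ∀ w : ℕ, ∃ C : ℝ,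 ∀ M : ℕ, ∃ Lmin : ℕ, Tube M β m C w Lmin) → ∃ β₀ : ℝ, ∀ β : ℝ, β₀ ≤ β → ∃ m : ℝ, 0 < m ∧ ∃ S₁ : ℕ, ∀ A B : YMSpecies G, ∃ C : ℝ, ∀ S n : ℕ, S₁ ≤ S → n ≤ S → |latticeConnectedCorr r.ρ β (2 * S + 1) A.F B.F n| ≤ C * Real.exp (-(m * n))) ↔
    Summit.QuantumFields.YangMills.Theses.ContractibleFibre.UniformLatticeGap := by
  constructor
  · intro h G _ _ _ _ _ _ hG r
    have hm : ‹MeasurableSpace G› = borel G := BorelSpace.measurable_eq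
    subst hm
    letI : MeasurableSpace G := borel G
    exact h G hG r ⟨0, fun β _ => ⟨0, fun w => ⟨2, fun M => ⟨0, tube_rate_zero G r M β w⟩⟩⟩⟩
  · intro hU G _ _ _ _ hG
    letI : MeasurableSpace G := borel G
    haveI : BorelSpace G := ⟨rfl⟩
    intro r Tube _
    exact hU G hG r

end Summit.QuantumFields.YangMills.Theorems.FibreToTorus.Negative

end
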